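import Summits.AtomisticToContinuum.FouriersLaw.Theses.CageBudgetFekete
import Summits.AtomisticToContinuum.FouriersLaw.Theorems.CageBudgetFeketeUnboundedHeatVarianceAbelForm
import Summits.AtomisticToContinuum.FouriersLaw.Theorems.CageBudgetFeketeUnboundedHeatVarianceChebyshevSandwich
import Summits.AtomisticToContinuum.FouriersLaw.Theorems.CageBudgetFeketeUnboundedHeatVarianceAbelSandwichTransfer
import Summits.AtomisticToContinuum.FouriersLaw.Theorems.CageBudgetFeketeUnboundedHeatVarianceIrOfNoFrozenSiteEnergy
import Summits.AtomisticToContinuum.FouriersLaw.Theorems.CageBudgetFeketeUnboundedHeatVarianceOfHoelderCorner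
import Summits.AtomisticToContinuum.FouriersLaw.Theorems.CageBudgetFeketeUnboundedHeatVarianceAbelProfileDomination
import Summits.AtomisticToContinuum.FouriersLaw.Theorems.CageBudgetFeketeUnboundedHeatVarianceIffExists
import Summits.AtomisticToContinuum.FouriersLaw.Theorems.CageBudgetFeketeUnboundedHeatVarianceNoFrozenSiteEnergyOfErgodic
import Summits.AtomisticToContinuum.FouriersLaw.Theorems.CageBudgetFeketeUnboundedHeatVarianceFlatFejerProfile
import Summits.AtomisticToContinuum.FouriersLaw.Theorems.CageBudgetFeketeUnboundedHeatVarianceEscapeInsufficient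
import Summits.AtomisticToContinuum.FouriersLaw.Theorems.CageBudgetFeketeUnboundedHeatVarianceIrOfSequentialFibreRelaxation
import Summits.AtomisticToContinuum.FouriersLaw.Theorems.CageBudgetFeketeUnboundedHeatVarianceNoFrozenSiteEnergyOfCesaroRelaxation
import Summits.AtomisticToContinuum.FouriersLaw.Theorems.CageBudgetFeketeUnboundedHeatVariancePOfEventualAbelEnergyPositivity
import Summits.AtomisticToContinuum.FouriersLaw.Theorems.CageBudgetFeketeUnboundedHeatVarianceFibrewiseRelaxationInsufficient

/-!
# Skeleton of crux `CageBudgetFekete.UnboundedHeatVariance` — line `Sketch` (Abel infrared sandwich)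
(item `stmt-AtomisticToContinuum-15771`, route `route-AtomisticToContinuum-CageBudgetFekete`, rank 4, sub-problem
`FouriersLaw`; lead `prover-line-stmt-AtomisticToContinuum-15771-c1-0`, continuation of line `birth`, 2026-08-17)

Crux (FIXED, concluded BY NAME below): in the shared arena (pinned chain `pinnedChain ω₂ lam β γ`, `ω₂, lam, β > 0`,
`T > 0`, shift- and momentum-reversal-invariant DLR state `μ`, `μ`-preserving shift-covariant `InfiniteChainDynamics D`,
absolutely convergent and continuous summed current autocorrelation `C`), the heat variance
`V(τ) = 2∫_{(0,τ]}(τ-s)C(s)ds` is unbounded above on `τ ≥ 0` (U).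

## Where the line stands (what is LANDED and used by name)

* Line `birth` (cycle 1) reduced U to its Abel form S2′: `ν⁻¹∫_{t>0}e^{-νt}C(t)dt → +∞` as `ν ↓ 0`
  (`Theorems…UnboundedHeatVariance.Birth.unboundedHeatVariance_iff_abel`, kernel-checked equivalence; S1 Bochner
  representation, S3 Cesàro–Fatou, glue G all landed: p161048, p161386, p162185).
* Route HoelderEscapeProfile LANDED the twelve-clause Abel fibre calculus for THIS arena
  (`Theorems.FibreCalculusSketch.fibreCalculus_proof : Theses.HoelderEscapeProfile.FibreCalculus`): with the split-bond
  site energy `h`, the energy kernel `S(x,t) = Cov(h₀, h_x∘φ_t)`, its Abel profile `S̄_ν(x) = ν∫₀^∞e^{-νt}S(x,t)dt`,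
  `f̂_ν(k) = Σ_x cos(kx)S̄_ν(x) ≥ 0`, `χ(k) = Σ_x cos(kx)S(x,0)`, `χ(0) > 0`: summability of `(1+x²)|S̄_ν|` and
  `(1+x²)|S(·,0)|`, conservation `Σ_x S̄_ν(x) = χ(0)`, the fibre identity `χ(k) − f̂_ν(k) = (2−2cos k)𝒢_ν(k)/ν` and the
  HELFAND–ABEL identity `A(ν) := ∫₀^∞e^{-νt}C = (ν/2)(Σ_x x²S̄_ν(x) − Σ_x x²S(x,0))`.

## Line `Sketch` — the Abel infrared sandwich (ideas `infrared-sandwich`, `fibre-helfand-no-dip` in Abel dress)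

By Helfand–Abel, `A(ν)/ν = ½ Σ_x x² ΔS̄_ν(x)` with the ENERGY DISPLACEMENT KERNEL `ΔS̄_ν := S̄_ν − S(·,0)`, `Σ_x ΔS̄_ν = 0`.
Chebyshev on the circle (`1 − cos(kx) ≤ x²(1 − cos k)` for `x ∈ ℤ`) gives, for every `k` with `cos k ≠ 1`,
  `Σ_x x² ΔS̄_ν⁺(x) ≥ Σ_x (1 − cos kx) ΔS̄_ν(x)/(1 − cos k) = (χ(k) − f̂_ν(k))/(1 − cos k)`,
so `A(ν)/ν = ½(P_ν − N_ν)` (positive / negative second moments of `ΔS̄_ν`) is large as soon as (IR) one long-wave energy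
mode has an Abel deficit `χ(k) − f̂_ν(k) ≥ M(2 − 2cos k)` with `M` large (NON-FREEZING beyond the `k²` threshold —
NECESSARY for U by the fibre identity and `k`-continuity of `𝒢_ν`) and (P) the anti-correlation halo `N_ν` never
carries more than a fraction `θ < 1` of the positive spread `P_ν` (RELATIVE NEGATIVE SPREAD, a one-sided shadow of
dynamical energy positivity; exact at the harmonic member, in the kinetic corner and hydrodynamically; MD: `N⁻/N⁺ ≤ 0.1`).
Monotonicity of `ν ↦ A(ν)/ν = ∫dρ/(ν²+ω²)` (landed) upgrades "large at one small `ν`" to the limit S2′, hence U.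

Registered stubs (4): `stub_chebyshevSandwich` (pure real analysis, S), `stub_abelSandwichTransfer` (plumbing over the
landed calculus, M), `stub_relativeNegativeSpread` (P, open sign input), `stub_infraredNonFreezing` (IR, open, necessary).
Extra edges registered by `stub-add` (not hypotheses of the composition): `stub_infraredNonFreezingOfNoFrozenSiteEnergy`
(mean-ergodic site energy `S̄_ν(0) → 0` ⟹ IR, wavenumber pigeonhole) and `stub_unboundedHeatVariance_of_hoelderCorner`
(HoelderEscapeProfile K1 ∧ K2 ⟹ U).

LEAD STATUS (prover-line-stmt-AtomisticToContinuum-15771-c1-0, 2026-08-17, cycle 2 = waves 1–3, ALL provable pieces LANDED):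
* S_A `stub_chebyshevSandwich` — p165461, `Theorems/CageBudgetFeketeUnboundedHeatVarianceChebyshevSandwich.lean`;
* S_T `stub_abelSandwichTransfer` — p165506, `Theorems/CageBudgetFeketeUnboundedHeatVarianceAbelSandwichTransfer.lean`;
* edge E `stub_infraredNonFreezingOfNoFrozenSiteEnergy` (no frozen site energy `S̄_ν(0) → 0` ⟹ IR, wavenumber pigeonhole) —
  p165351, `…IrOfNoFrozenSiteEnergy.lean`;
* edge HC `stub_unboundedHeatVariance_of_hoelderCorner` (HoelderEscapeProfile K1 ∧ CornerNoDip ⟹ U) — p165723, `…OfHoelderCorner.lean`;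
* edge N `stub_infraredNonFreezing_of_unboundedHeatVariance` (NECESSITY: U ⟹ IR; k-continuity at 0 of the Fejér quotient, no
  light cone) — p166691, `…IrOfUnboundedHeatVariance.lean`;
* edge K `stub_infraredNonFreezing_of_localEnergyHalfHoelder` (K1 alone ⟹ IR) — p166379, `…IrOfLocalEnergyHalfHoelder.lean`;
* edge E2 `stub_infraredNonFreezing_of_bondHeatSpread` (Abel single-bond heat spread `Σ_x|x|ΔS̄_ν(x)` unbounded ⟹ IR; Fejér identity
  `∫_{-π}^{π}(1−cos kx)/(1−cos k)dk = 2π|x|`, average ≤ sup) — p167443, `…IrOfBondHeatSpread.lean`;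
* edge E4 `stub_relativeNegativeSpread_of_abelEnergyPositivity` (Abel-averaged dynamical energy positivity `S̄_ν ≥ 0` ⟹ P with
  `θ = 0`) — p167137, `…POfAbelEnergyPositivity.lean`.
The `Holds.stub_*` of S_A and S_T below are `exact` the landed theorems; the composition takes ONLY the two open stubs:
`UnboundedHeatVariance_of : stub_relativeNegativeSpread → stub_infraredNonFreezing → U`. Sorries left: 2 (P, IR) = the crux's
open content, split into a SIGN statement (P ⟸ AbelDEP) and a NECESSARY ergodic statement (U ⟹ IR ⟸ BondHeatSpread ⟸ … and
IR ⟸ NoFrozenSiteEnergy ⟸ K1). Implication web (all arrows kernel-checked): U ⟺ IR given P; U ⟸ K1 ∧ CornerNoDip; U ⟸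
CoercivePulse.LinearSpread ∧ PulseCalculus (p162677, line birth).

LEAD STATUS (prover-line-stmt-AtomisticToContinuum-15771-c2-0, 2026-08-17, cycle 3 = waves 4–5, NINE more satellites LANDED, all
`--supports stmt-15771`, namespace `…Theorems.UnboundedHeatVariance.Sketch`):
* D `stub_abelProfileDomination` (|S̄_ν(x)| ≤ S̄_ν(0); + `totalEscape_of_noFrozenSiteEnergy`) — p172851, `…AbelProfileDomination.lean`;
* R `stub_unboundedHeatVariance_iff_exists` (CANONICAL REDUCTION: U ⟺ "∃ guarded pair with unbounded V" at each parameter point;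
  + `unboundedHeatVariance_iff_dropRegularity`: the two regularity hypotheses of U are idle) — p172515, `…IffExists.lean`;
* Erg `stub_noFrozenSiteEnergy_of_ergodic` (Mathlib `Ergodic (D.flow 1) μ` ⟹ S̄_ν(0) → 0; + `infraredNonFreezing_of_ergodic`) — p173036;
* SR `stub_noFrozenSiteEnergy_of_cesaroRelaxation` (Cesàro mean-ergodicity of h₀ ⟹ S̄_ν(0) → 0; + pointwise-relaxation and IR riders) — p173547;
* SF `stub_infraredNonFreezing_of_sequentialFibreRelaxation` (no conserved energy component along SOME k_j → 0 ⟹ IR; weakest rung) — p173430;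
* PE `stub_relativeNegativeSpread_of_eventualAbelEnergyPositivity` (S̄_ν ≥ 0 outside a fixed core ⟹ P, θ = 0) — p173550;
* F `stub_flatFejerProfile` + X `stub_escapeInsufficient` (PROFILE-LEVEL TIGHTNESS: all sandwich clauses ∧ IR ∧ total escape at rate √ν
  hold for an explicit flat-topped Fejér family whose kernel `C = cos/4` is caged — escape/ergodic inputs cannot replace P) — p173030, p172810;
* FR `stub_fibrewiseRelaxationInsufficient` (SPECTRAL TIGHTNESS: σ_k{0} = 0 for every k ∉ 2πℤ ∧ ρ_k → ρ₀ weakly ∧ σ_0 = χδ₀ do not force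
  the infrared charge of ρ₀: four-atom witness with diffusive dispersion η(k) = 1 − cos k) — p173666.
IMPLICATION WEB (all kernel-checked): U ⟺ ∃-form; U ⟸ P ∧ IR; U ⟹ IR; IR ⟸ SF ⟸ NoFrozen ⟸ {SR ⟸ pointwise relaxation; Erg; K1};
IR ⟸ BondHeatSpread; P ⟸ PE ⟸ AbelDEP; U ⟸ K1 ∧ CornerNoDip; U ⟸ LinearSpread ∧ PulseCalculus; and NEGATIVELY frame ⇏ U (AbstractCage),
frame ∧ IR ∧ √ν-escape ⇏ U (X), fibrewise relaxation ∧ k-continuity ⇏ infrared charge (FR). Sorries left: 2 = P (sign) and IR (ergodic,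
necessary) — the crux's open physical content; nothing registered remains provable.
-/

noncomputable section

namespace Summit.AtomisticToContinuum.FouriersLaw.Cruxes.UnboundedHeatVariance.Sketch

open MeasureTheory Set Filter Topology

/-! ## Part I — registered stubs (`sorry` only here) -/

/-- **S_A — `stub_chebyshevSandwich` (Chebyshev comparison on the circle; pure real analysis, size S).** For a
sequence `Δ : ℤ → ℝ` with `Σ(1+x²)|Δ x| < ∞` and any `k` with `cos k ≠ 1`:
`Σ_x (1 − cos(kx))Δ(x) ≤ (1 − cos k)·Σ_x x²·max(Δ x, 0)` — from `0 ≤ 1 − cos(kx) ≤ x²(1 − cos k)` for integer `x`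
(`|sin(x·k/2)| ≤ |x|·|sin(k/2)|`). [folklore] -/
theorem Holds.stub_chebyshevSandwich :
    ∀ Δ : ℤ → ℝ, Summable (fun x : ℤ => (1 + (x : ℝ) ^ 2) * |Δ x|) → ∀ k : ℝ, Real.cos k ≠ 1 → ∑' x : ℤ, (1 - Real.cos (k * (x : ℝ))) * Δ x ≤ (1 - Real.cos k) * ∑' x : ℤ, (x : ℝ) ^ 2 * max (Δ x) 0 := by
  exact _root_.Summit.AtomisticToContinuum.FouriersLaw.Theorems.UnboundedHeatVariance.Sketch.stub_chebyshevSandwich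

/-- **S_T — `stub_abelSandwichTransfer` (the Abel infrared sandwich; plumbing over LANDED calculus, size M).**
Given S_A: in the crux's arena, RELATIVE NEGATIVE SPREAD (P) and INFRARED NON-FREEZING (IR) of the Abel energy profile
imply the Abel divergence S2′ `ν⁻¹∫e^{-νt}C → ∞`. Uses `Theses.HoelderEscapeProfile.FibreCalculus` (landed
`fibreCalculus_proof`: summability, conservation `Σ S̄_ν = χ(0)`, Helfand–Abel identity), S_A, and monotonicity of the
Poisson integrals (`Birth.inv_mul_abel_eq_integral_inv_sq_add`, `Birth.integral_inv_sq_add_antitone`, S1). [folklore] -/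
theorem Holds.stub_abelSandwichTransfer :
    (∀ Δ : ℤ → ℝ, Summable (fun x : ℤ => (1 + (x : ℝ) ^ 2) * |Δ x|) → ∀ k : ℝ, Real.cos k ≠ 1 → ∑' x : ℤ, (1 - Real.cos (k * (x : ℝ))) * Δ x ≤ (1 - Real.cos k) * ∑' x : ℤ, (x : ℝ) ^ 2 * max (Δ x) 0) → ∀ ω₂ lam β γ : ℝ, 0 < ω₂ → 0 < lam → 0 < β → ∀ T : ℝ, 0 < T → ∀ μ : MeasureTheory.Measure Literature.MathematicalPhysics.KineticTheory.HeatConduction.ChainConfig, (Literature.MathematicalPhysics.KineticTheory.HeatConduction.pinnedChain ω₂ lam β γ).IsChainGibbsMeasure T μ → Literature.MathematicalPhysics.KineticTheory.HeatConduction.IsShiftInvariant μ → μ.map (fun σ : Literature.MathematicalPhysics.KineticTheory.HeatConduction.ChainConfig => fun x : ℤ => ((σ x).1, -(σ x).2)) = μ → ∀ D : Literature.MathematicalPhysics.KineticTheory.HeatConduction.InfiniteChainDynamics (Literature.MathematicalPhysics.KineticTheory.HeatConduction.pinnedChain ω₂ lam β γ), D.PreservesMeasure μ → (∀ t : ℝ,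 ∀ᵐ σ ∂μ, D.flow t (Literature.MathematicalPhysics.KineticTheory.HeatConduction.shift σ) = Literature.MathematicalPhysics.KineticTheory.HeatConduction.shift (D.flow t σ)) → (∀ t : ℝ, D.HasAbsConvergentCorrelation μ t) → Continuous (fun t : ℝ => D.currentCorrelation μ t) → ∀ h : Literature.MathematicalPhysics.KineticTheory.HeatConduction.ChainConfig → ℤ → ℝ, h = (fun (σ : Literature.MathematicalPhysics.KineticTheory.HeatConduction.ChainConfig) (x : ℤ) => (σ x).2 ^ 2 / 2 + (Literature.MathematicalPhysics.KineticTheory.HeatConduction.pinnedChain ω₂ lam β γ).U (σ x).1 + ((Literature.MathematicalPhysics.KineticTheory.HeatConduction.pinnedChain ω₂ lam β γ).V ((σ (x + 1)).1 - (σ x).1) + (Literature.MathematicalPhysics.KineticTheory.HeatConduction.pinnedChain ω₂ lam β γ).V ((σ x).1 - (σ (x - 1)).1)) / 2) → ∀ S : ℤ → ℝ → ℝ, S = (fun (x : ℤ) (t : ℝ) => ∫ σ, (h σ 0 - ∫ σ', h σ' 0 ∂μ) * (h (D.flow t σ) x - ∫ σ', h σ' 0 ∂μ) ∂μ) → ∀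 Sb : ℝ → ℤ → ℝ, Sb = (fun (ν : ℝ) (x : ℤ) => ν * ∫ t in Set.Ioi (0:ℝ), Real.exp (-(ν * t)) * S x t) → ∀ fh : ℝ → ℝ → ℝ, fh = (fun (ν k : ℝ) => ∑' x : ℤ, Real.cos (k * (x : ℝ)) * Sb ν x) → ∀ χk : ℝ → ℝ, χk = (fun k : ℝ => ∑' x : ℤ, Real.cos (k * (x : ℝ)) * S x 0) → (∃ θ K ν₀ : ℝ, θ < 1 ∧ 0 < ν₀ ∧ ∀ ν : ℝ, 0 < ν → ν < ν₀ → ∑' x : ℤ, (x : ℝ) ^ 2 * max (S x 0 - Sb ν x) 0 ≤ θ * (∑' x : ℤ, (x : ℝ) ^ 2 * max (Sb ν x - S x 0) 0) + K) → (∀ M ν₁ : ℝ, 0 < ν₁ → ∃ k : ℝ, Real.cos k ≠ 1 ∧ ∃ ν : ℝ, 0 < ν ∧ ν < ν₁ ∧ M * (2 - 2 * Real.cos k) ≤ χk k - fh ν k) → Filter.Tendsto (fun ν : ℝ => ν⁻¹ * ∫ t in Set.Ioi (0:ℝ), Real.exp (-(ν * t)) * D.currentCorrelation μ t) (nhdsWithin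 (0:ℝ) (Set.Ioi 0)) Filter.atTop := by
  exact _root_.Summit.AtomisticToContinuum.FouriersLaw.Theorems.UnboundedHeatVariance.Sketch.stub_abelSandwichTransfer

/-- **S_P — `stub_relativeNegativeSpread` (P: the anti-correlation halo of the Abel energy displacement kernel is
dominated; OPEN sign input, shadow of dynamical energy positivity).** In the arena, with `ΔS̄_ν = S̄_ν − S(·,0)`:
`∃ θ < 1, K, ν₀ > 0, ∀ ν ∈ (0,ν₀): Σ_x x²ΔS̄_ν⁻(x) ≤ θ·Σ_x x²ΔS̄_ν⁺(x) + K`. Exact with `θ = 0` at the harmonic member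
(Isserlis, `S ≥ 0`), at leading kinetic order (positivity-preserving linearised Boltzmann) and hydrodynamically (heat
kernel); static short-range negatives `Σ_x x²S(x,0)⁺ < ∞` sit in `K`. Why it might fail: a coherent energy ECHO /
weak second sound (negative lobes of `S(x,t)` at hydrodynamic range keeping pace with the spread). [conjectural;
card infrared-sandwich (P); MendlSpohn2015 §4; Spohn1991 II §6] -/
theorem Holds.stub_relativeNegativeSpread :
    ∀ ω₂ lam β γ : ℝ, 0 < ω₂ → 0 < lam → 0 < β → ∀ T : ℝ, 0 < T → ∀ μ : MeasureTheory.Measure Literature.MathematicalPhysics.KineticTheory.HeatConduction.ChainConfig, (Literature.MathematicalPhysics.KineticTheory.HeatConduction.pinnedChain ω₂ lam β γ).IsChainGibbsMeasure T μ → Literature.MathematicalPhysics.KineticTheory.HeatConduction.IsShiftInvariant μ → μ.map (fun σ : Literature.MathematicalPhysics.KineticTheory.HeatConduction.ChainConfig => fun x : ℤ => ((σ x).1, -(σ x).2)) = μ → ∀ D : Literature.MathematicalPhysics.KineticTheory.HeatConduction.InfiniteChainDynamics (Literature.MathematicalPhysics.KineticTheory.HeatConduction.pinnedChain ω₂ lam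 β γ), D.PreservesMeasure μ → (∀ t : ℝ, ∀ᵐ σ ∂μ, D.flow t (Literature.MathematicalPhysics.KineticTheory.HeatConduction.shift σ) = Literature.MathematicalPhysics.KineticTheory.HeatConduction.shift (D.flow t σ)) → (∀ t : ℝ, D.HasAbsConvergentCorrelation μ t) → Continuous (fun t : ℝ => D.currentCorrelation μ t) → ∀ h : Literature.MathematicalPhysics.KineticTheory.HeatConduction.ChainConfig → ℤ → ℝ, h = (fun (σ : Literature.MathematicalPhysics.KineticTheory.HeatConduction.ChainConfig) (x : ℤ) => (σ x).2 ^ 2 / 2 + (Literature.MathematicalPhysics.KineticTheory.HeatConduction.pinnedChain ω₂ lam β γ).U (σ x).1 + ((Literature.MathematicalPhysics.KineticTheory.HeatConduction.pinnedChain ω₂ lam β γ).V ((σ (x + 1)).1 - (σ x).1) + (Literature.MathematicalPhysics.KineticTheory.HeatConduction.pinnedChain ω₂ lam β γ).V ((σ x).1 - (σ (x - 1)).1)) / 2) → ∀ S : ℤ → ℝ → ℝ, S = (fun (x : ℤ) (t : ℝ) => ∫ σ, (h σ 0 - ∫ σ', h σ' 0 ∂μ) * (h (D.flow t σ) x - ∫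 σ', h σ' 0 ∂μ) ∂μ) → ∀ Sb : ℝ → ℤ → ℝ, Sb = (fun (ν : ℝ) (x : ℤ) => ν * ∫ t in Set.Ioi (0:ℝ), Real.exp (-(ν * t)) * S x t) → ∃ θ K ν₀ : ℝ, θ < 1 ∧ 0 < ν₀ ∧ ∀ ν : ℝ, 0 < ν → ν < ν₀ → ∑' x : ℤ, (x : ℝ) ^ 2 * max (S x 0 - Sb ν x) 0 ≤ θ * (∑' x : ℤ, (x : ℝ) ^ 2 * max (Sb ν x - S x 0) 0) + K := by
  sorry

/-- **S_IR — `stub_infraredNonFreezing` (IR: one long-wavelength energy mode is not frozen to order `k²`; OPEN,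
NECESSARY for U).** In the arena: `∀ M, ∀ ν₁ > 0, ∃ k (cos k ≠ 1), ∃ ν ∈ (0,ν₁): M(2 − 2cos k) ≤ χ(k) − f̂_ν(k)` — by the
landed fibre identity this is `sup_{k≠0, ν<ν₁} 𝒢_ν(k)/ν = ∞` (the fibred Abel conductivity per `ν` is unbounded).
Necessary: U ⟹ `A(ν)/ν → ∞` ⟹ (k-continuity of `𝒢_ν`) IR. Sufficient inputs, weakest first: no frozen site energy
(`S̄_ν(0) → 0`, registered edge `stub_infraredNonFreezingOfNoFrozenSiteEnergy`) ⟸ ergodicity of `(μ_T, φ)`. Fails exactly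
for an ideal energy glass (`1 − f_k = O(k²)`: Anderson / asymptotically localised chains). [DeRoeckHuveneers2015;
AjankiHuveneers2011; card fibre-helfand-no-dip (B); card infrared-sandwich (IR)] -/
theorem Holds.stub_infraredNonFreezing :
    ∀ ω₂ lam β γ : ℝ, 0 < ω₂ → 0 < lam → 0 < β → ∀ T : ℝ, 0 < T → ∀ μ : MeasureTheory.Measure Literature.MathematicalPhysics.KineticTheory.HeatConduction.ChainConfig, (Literature.MathematicalPhysics.KineticTheory.HeatConduction.pinnedChain ω₂ lam β γ).IsChainGibbsMeasure T μ → Literature.MathematicalPhysics.KineticTheory.HeatConduction.IsShiftInvariant μ → μ.map (fun σ : Literature.MathematicalPhysics.KineticTheory.HeatConduction.ChainConfig => fun x : ℤ => ((σ x).1, -(σ x).2)) = μ → ∀ D : Literature.MathematicalPhysics.KineticTheory.HeatConduction.InfiniteChainDynamics (Literature.MathematicalPhysics.KineticTheory.HeatConduction.pinnedChain ω₂ lam β γ), D.PreservesMeasure μ → (∀ t : ℝ, ∀ᵐ σ ∂μ, D.flow t (Literature.MathematicalPhysics.KineticTheory.HeatConduction.shift σ) = Literature.MathematicalPhysics.KineticTheory.HeatConduction.shift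 (D.flow t σ)) → (∀ t : ℝ, D.HasAbsConvergentCorrelation μ t) → Continuous (fun t : ℝ => D.currentCorrelation μ t) → ∀ h : Literature.MathematicalPhysics.KineticTheory.HeatConduction.ChainConfig → ℤ → ℝ, h = (fun (σ : Literature.MathematicalPhysics.KineticTheory.HeatConduction.ChainConfig) (x : ℤ) => (σ x).2 ^ 2 / 2 + (Literature.MathematicalPhysics.KineticTheory.HeatConduction.pinnedChain ω₂ lam β γ).U (σ x).1 + ((Literature.MathematicalPhysics.KineticTheory.HeatConduction.pinnedChain ω₂ lam β γ).V ((σ (x + 1)).1 - (σ x).1) + (Literature.MathematicalPhysics.KineticTheory.HeatConduction.pinnedChain ω₂ lam β γ).V ((σ x).1 - (σ (x - 1)).1)) / 2) → ∀ S : ℤ → ℝ → ℝ, S = (fun (x : ℤ) (t : ℝ) => ∫ σ, (h σ 0 - ∫ σ', h σ' 0 ∂μ) * (h (D.flow t σ) x - ∫ σ', h σ' 0 ∂μ) ∂μ) → ∀ Sb : ℝ → ℤ → ℝ, Sb = (fun (ν : ℝ) (x : ℤ) => ν * ∫ t in Set.Ioi (0:ℝ), Real.exp (-(ν * t)) * S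 x t) → ∀ fh : ℝ → ℝ → ℝ, fh = (fun (ν k : ℝ) => ∑' x : ℤ, Real.cos (k * (x : ℝ)) * Sb ν x) → ∀ χk : ℝ → ℝ, χk = (fun k : ℝ => ∑' x : ℤ, Real.cos (k * (x : ℝ)) * S x 0) → ∀ M ν₁ : ℝ, 0 < ν₁ → ∃ k : ℝ, Real.cos k ≠ 1 ∧ ∃ ν : ℝ, 0 < ν ∧ ν < ν₁ ∧ M * (2 - 2 * Real.cos k) ≤ χk k - fh ν k := by
  sorry

/-! ### Part I-bis — edges and tightness stubs registered by the continuation lead c2 (2026-08-17, cycle 3):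
D (profile domination), R (canonical reduction), Erg (ergodic ⟹ no frozen site energy), F + X (escape does not force
spread: the sign input is indispensable). None is a hypothesis of `UnboundedHeatVariance_of`. -/

/-- **D — `stub_abelProfileDomination` (edge, pure consequence of the LANDED fibre calculus, size S).** In the arena the
Abel profile is dominated by its value at the origin: `|S̄_ν(x)| ≤ S̄_ν(0)` for every `ν > 0`, `x ∈ ℤ` — Fourier inversion
`S̄_ν(x) = (2π)⁻¹∫_{-π}^{π} f̂_ν(k)cos(kx)dk` (cosine-series orthogonality, `Literature.Analysis.Fourier`) with `f̂_ν ≥ 0`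
(FibreCalculus clause (8)) and `∫f̂_ν = 2πS̄_ν(0)` (clause (9)). Consequence (rider, same file): NO FROZEN SITE ENERGY
`S̄_ν(0) → 0` upgrades to TOTAL ESCAPE `sup_x |S̄_ν(x)| → 0`. [folklore] -/
theorem Holds.stub_abelProfileDomination :
    ∀ ω₂ lam β γ : ℝ, 0 < ω₂ → 0 < lam → 0 < β → ∀ T : ℝ, 0 < T → ∀ μ : MeasureTheory.Measure Literature.MathematicalPhysics.KineticTheory.HeatConduction.ChainConfig, (Literature.MathematicalPhysics.KineticTheory.HeatConduction.pinnedChain ω₂ lam β γ).IsChainGibbsMeasure T μ → Literature.MathematicalPhysics.KineticTheory.HeatConduction.IsShiftInvariant μ → μ.map (fun σ : Literature.MathematicalPhysics.KineticTheory.HeatConduction.ChainConfig => fun x : ℤ => ((σ x).1, -(σ x).2)) = μ → ∀ D : Literature.MathematicalPhysics.KineticTheory.HeatConduction.InfiniteChainDynamics (Literature.MathematicalPhysics.KineticTheory.HeatConduction.pinnedChain ω₂ lam β γ), D.PreservesMeasure μ → (∀ t : ℝ, ∀ᵐ σ ∂μ, D.flow t (Literature.MathematicalPhysics.KineticTheory.HeatConduction.shift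 σ) = Literature.MathematicalPhysics.KineticTheory.HeatConduction.shift (D.flow t σ)) → (∀ t : ℝ, D.HasAbsConvergentCorrelation μ t) → Continuous (fun t : ℝ => D.currentCorrelation μ t) → ∀ h : Literature.MathematicalPhysics.KineticTheory.HeatConduction.ChainConfig → ℤ → ℝ, h = (fun (σ : Literature.MathematicalPhysics.KineticTheory.HeatConduction.ChainConfig) (x : ℤ) => (σ x).2 ^ 2 / 2 + (Literature.MathematicalPhysics.KineticTheory.HeatConduction.pinnedChain ω₂ lam β γ).U (σ x).1 + ((Literature.MathematicalPhysics.KineticTheory.HeatConduction.pinnedChain ω₂ lam β γ).V ((σ (x + 1)).1 - (σ x).1) + (Literature.MathematicalPhysics.KineticTheory.HeatConduction.pinnedChain ω₂ lam β γ).V ((σ x).1 - (σ (x - 1)).1)) / 2) → ∀ S : ℤ → ℝ → ℝ, S = (fun (x : ℤ) (t : ℝ) => ∫ σ, (h σ 0 - ∫ σ', h σ' 0 ∂μ) * (h (D.flow t σ) x - ∫ σ', h σ' 0 ∂μ) ∂μ) → ∀ Sb : ℝ → ℤ → ℝ, Sb = (fun (ν : ℝ) (x : ℤ) => ν * ∫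 t in Set.Ioi (0:ℝ), Real.exp (-(ν * t)) * S x t) → ∀ ν : ℝ, 0 < ν → ∀ x : ℤ, |Sb ν x| ≤ Sb ν 0 := by
  exact _root_.Summit.AtomisticToContinuum.FouriersLaw.Theorems.UnboundedHeatVariance.Sketch.stub_abelProfileDomination

/-- **R — `stub_unboundedHeatVariance_iff_exists` (edge: CANONICAL REDUCTION of the crux, size M).** U quantifies over
EVERY guarded pair `(μ, D)`; but the shift-invariant DLR state of the pinned chain is unique
(`eq_of_isChainGibbsMeasure_of_isShiftInvariant_pinnedChain`) and every `μ`-preserving dynamics is `μ`-a.e. the canonical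
Buttà–Marchioro flow at all times (`HeatVarianceCalculus.CanonicalRigidity.flow_ae_eq_canonical`), so all guarded pairs at
the same `(ω₂, lam, β, γ, T)` have the SAME summed current autocorrelation, hence the same heat variance; a guarded pair
exists (`cageBudgetFekete_symmetricSetup_proof`) and its `C_T` is absolutely convergent and continuous
(`heatVarianceCalculus_proof`). Hence U ⟺ "at every parameter point SOME guarded pair has unbounded heat variance": the two
regularity hypotheses of U are idle and no hypothesis of U can be mutated — U is a property of `(ω₂, lam, β, T)` alone.
[folklore] -/
theorem Holds.stub_unboundedHeatVariance_iff_exists :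
    (_root_.Summit.AtomisticToContinuum.FouriersLaw.Theses.CageBudgetFekete.UnboundedHeatVariance ↔ (∀ ω₂ lam β γ : ℝ, 0 < ω₂ → 0 < lam → 0 < β → ∀ T : ℝ, 0 < T → ∃ μ : MeasureTheory.Measure Literature.MathematicalPhysics.KineticTheory.HeatConduction.ChainConfig, (Literature.MathematicalPhysics.KineticTheory.HeatConduction.pinnedChain ω₂ lam β γ).IsChainGibbsMeasure T μ ∧ Literature.MathematicalPhysics.KineticTheory.HeatConduction.IsShiftInvariant μ ∧ μ.map (fun σ : Literature.MathematicalPhysics.KineticTheory.HeatConduction.ChainConfig => fun x : ℤ => ((σ x).1, -(σ x).2)) = μ ∧ ∃ D : Literature.MathematicalPhysics.KineticTheory.HeatConduction.InfiniteChainDynamics (Literature.MathematicalPhysics.KineticTheory.HeatConduction.pinnedChain ω₂ lam β γ), D.PreservesMeasure μ ∧ (∀ t : ℝ, ∀ᵐ σ ∂μ, D.flow t (Literature.MathematicalPhysics.KineticTheory.HeatConduction.shift σ) = Literature.MathematicalPhysics.KineticTheory.HeatConduction.shift (D.flow t σ)) ∧ ∀ R : ℝ, ∃ τ : ℝ, 0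 ≤ τ ∧ R < 2 * ∫ s in Set.Ioc (0:ℝ) τ, (τ - s) * D.currentCorrelation μ s)) := by
  exact _root_.Summit.AtomisticToContinuum.FouriersLaw.Theorems.UnboundedHeatVariance.Sketch.stub_unboundedHeatVariance_iff_exists

/-- **Erg — `stub_noFrozenSiteEnergy_of_ergodic` (edge: the textbook ergodic hypothesis feeds the IR ladder, size L).**
In the arena, if the time-one map of the dynamics is ERGODIC for `μ` (Mathlib `Ergodic (D.flow 1) μ`), then the site
energy has no frozen component: `S̄_ν(0) = ν∫₀^∞e^{-νt}Cov(h₀, h₀∘φ_t)dt → 0` as `ν ↓ 0` — von Neumann's mean ergodic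
theorem (Mathlib `ContinuousLinearMap.tendsto_birkhoffAverage_orthogonalProjection`) for the Koopman isometry of `φ_1`
on `L²(μ)` applied to `φ_θ`-translates of the centred site energy (fixed space = constants by
`Ergodic.ae_eq_const_of_ae_eq_comp_ae`), then Cesàro ⇒ Abel uniformly in `θ ∈ [0,1)`. With the LANDED edge E
(`stub_infraredNonFreezingOfNoFrozenSiteEnergy`, p165351) this gives: time-one ergodicity ⟹ IR. [folklore; vonNeumann1932] -/
theorem Holds.stub_noFrozenSiteEnergy_of_ergodic :
    ∀ ω₂ lam β γ : ℝ, 0 < ω₂ → 0 < lam → 0 < β → ∀ T : ℝ, 0 < T → ∀ μ : MeasureTheory.Measure Literature.MathematicalPhysics.KineticTheory.HeatConduction.ChainConfig, (Literature.MathematicalPhysics.KineticTheory.HeatConduction.pinnedChain ω₂ lam β γ).IsChainGibbsMeasure T μ → Literature.MathematicalPhysics.KineticTheory.HeatConduction.IsShiftInvariant μ → μ.map (fun σ : Literature.MathematicalPhysics.KineticTheory.HeatConduction.ChainConfig => fun x : ℤ => ((σ x).1, -(σ x).2)) = μ → ∀ D : Literature.MathematicalPhysics.KineticTheory.HeatConduction.InfiniteChainDynamics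 (Literature.MathematicalPhysics.KineticTheory.HeatConduction.pinnedChain ω₂ lam β γ), D.PreservesMeasure μ → (∀ t : ℝ, ∀ᵐ σ ∂μ, D.flow t (Literature.MathematicalPhysics.KineticTheory.HeatConduction.shift σ) = Literature.MathematicalPhysics.KineticTheory.HeatConduction.shift (D.flow t σ)) → (∀ t : ℝ, D.HasAbsConvergentCorrelation μ t) → Continuous (fun t : ℝ => D.currentCorrelation μ t) → _root_.Ergodic (D.flow 1) μ → ∀ h : Literature.MathematicalPhysics.KineticTheory.HeatConduction.ChainConfig → ℤ → ℝ, h = (fun (σ : Literature.MathematicalPhysics.KineticTheory.HeatConduction.ChainConfig) (x : ℤ) => (σ x).2 ^ 2 / 2 + (Literature.MathematicalPhysics.KineticTheory.HeatConduction.pinnedChain ω₂ lam β γ).U (σ x).1 + ((Literature.MathematicalPhysics.KineticTheory.HeatConduction.pinnedChain ω₂ lam β γ).V ((σ (x + 1)).1 - (σ x).1) + (Literature.MathematicalPhysics.KineticTheory.HeatConduction.pinnedChain ω₂ lam β γ).V ((σ x).1 - (σ (x - 1)).1)) / 2) → ∀ S : ℤ → ℝ → ℝ, S = (fun (x : ℤ)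 (t : ℝ) => ∫ σ, (h σ 0 - ∫ σ', h σ' 0 ∂μ) * (h (D.flow t σ) x - ∫ σ', h σ' 0 ∂μ) ∂μ) → ∀ Sb : ℝ → ℤ → ℝ, Sb = (fun (ν : ℝ) (x : ℤ) => ν * ∫ t in Set.Ioi (0:ℝ), Real.exp (-(ν * t)) * S x t) → Filter.Tendsto (fun ν : ℝ => Sb ν 0) (nhdsWithin (0:ℝ) (Set.Ioi 0)) (nhds 0) := by
  exact _root_.Summit.AtomisticToContinuum.FouriersLaw.Theorems.UnboundedHeatVariance.Sketch.stub_noFrozenSiteEnergy_of_ergodic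

/-- **F — `stub_flatFejerProfile` (pure finite trigonometric algebra, size M).** The FLAT-TOPPED FEJÉR PROFILE on `ℤ`:
with `a_n(x) = n⁻²#{(i,j) ∈ [0,n)² : i − j = x} = (n − |x|)⁺/n²` (Fejér weights, cosine transform
`u_n(k) = n⁻²|Σ_{i<n}e^{iki}|² ∈ [0,1]`), `c_n = a_n ⋆ a_n` (transform `u_n²`) and the discrete Laplacian term
(transform `(1 − cos k)u_n`), the profile `P_{n,m} = 2a_n − c_n − m(a_n − ½a_n(·−1) − ½a_n(·+1))` has transform
`2u_n − u_n² − m(1 − cos k)u_n ∈ [0,1]` (flat top: value `1`, curvature `−m` at `k = 0`; vanishes at `k = 2π/n`), total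
mass `1`, second moment EXACTLY `m`, sup-norm `≤ 4/n`, support in `[−2n, 2n]`. [folklore; Fejér 1904] -/
theorem Holds.stub_flatFejerProfile :
    ∀ a : ℕ → ℤ → ℝ, a = (fun (n : ℕ) (x : ℤ) => ((n : ℝ) ^ 2)⁻¹ * ∑ i ∈ Finset.range n, ∑ j ∈ Finset.range n, if (i : ℤ) - (j : ℤ) = x then (1 : ℝ) else 0) → ∀ c : ℕ → ℤ → ℝ, c = (fun (n : ℕ) (x : ℤ) => ((n : ℝ) ^ 4)⁻¹ * ∑ i ∈ Finset.range n, ∑ j ∈ Finset.range n, ∑ i' ∈ Finset.range n, ∑ j' ∈ Finset.range n, if (i : ℤ) - (j : ℤ) + ((i' : ℤ) - (j' : ℤ)) = x then (1 : ℝ) else 0) → ∀ P : ℕ → ℝ → ℤ → ℝ, P = (fun (n : ℕ) (m : ℝ) (x : ℤ) => 2 * a n x - c n x - m * (a n x - (a n (x - 1) + a n (x + 1)) / 2)) → ∀ n : ℕ, 2 ≤ n → ∀ m : ℝ, 0 ≤ m → m ≤ 1 / 2 → (∀ x : ℤ, 2 * (n : ℤ) < |x| → P n m x = 0) ∧ Summable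 (fun x : ℤ => (1 + (x : ℝ) ^ 2) * |P n m x|) ∧ ∑' x : ℤ, P n m x = 1 ∧ ∑' x : ℤ, (x : ℝ) ^ 2 * P n m x = m ∧ (∀ x : ℤ, |P n m x| ≤ 4 / (n : ℝ)) ∧ (∀ k : ℝ, 0 ≤ ∑' x : ℤ, Real.cos (k * (x : ℝ)) * P n m x ∧ ∑' x : ℤ, Real.cos (k * (x : ℝ)) * P n m x ≤ 1) ∧ ∑' x : ℤ, Real.cos (2 * Real.pi / (n : ℝ) * (x : ℝ)) * P n m x = 0 := by
  exact _root_.Summit.AtomisticToContinuum.FouriersLaw.Theorems.UnboundedHeatVariance.Sketch.stub_flatFejerProfile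

/-- **X — `stub_escapeInsufficient` (TIGHTNESS of the line: escape-type inputs cannot replace the sign input P; size M,
over F).** There are abstract profile data — a static profile `S₀`, Abel profiles `S̄_ν` and the kernel `C = c₀cos` —
satisfying EVERY profile-level clause the sandwich consumes (weighted summability, conservation `Σ S̄_ν = Σ S₀ = χ(0) > 0`,
static structure factor `χ ≥ 0`, Bochner positivity `f̂_ν ≥ 0`, fibre dissipativity `f̂_ν ≤ χ`, the Helfand–Abel identity
with the continuous positive-type kernel `C = c₀cos = ∫cos(ωt)d(c₀δ₁)`), together with INFRARED NON-FREEZING (IR) and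
TOTAL ESCAPE AT THE HÖLDER-½ RATE `sup_x|S̄_ν(x)| ≤ √ν` (so no frozen site energy, K1 of HoelderEscapeProfile, and the
conclusion of D all hold) — whose heat variance is nevertheless CAGED (`V ≤ 4c₀`) and whose Abel function does not
diverge. Witness: `S₀ = δ₀`, `S̄_ν = P_{n(ν),m(ν)}` of F with `n(ν) = ⌈4/√ν⌉₊ + 2`, `m(ν) = (1/2)/(1 + ν²)`, `c₀ = 1/4`.
Hence, at the level of these clauses, U needs a SIGN/shape input (P, CornerNoDip, …): ergodic inputs on the energy
density alone — however quantitative — do not force the spread `Σx²ΔS̄_ν → ∞`. [folklore] -/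
theorem Holds.stub_escapeInsufficient :
    (∀ a : ℕ → ℤ → ℝ, a = (fun (n : ℕ) (x : ℤ) => ((n : ℝ) ^ 2)⁻¹ * ∑ i ∈ Finset.range n, ∑ j ∈ Finset.range n, if (i : ℤ) - (j : ℤ) = x then (1 : ℝ) else 0) → ∀ c : ℕ → ℤ → ℝ, c = (fun (n : ℕ) (x : ℤ) => ((n : ℝ) ^ 4)⁻¹ * ∑ i ∈ Finset.range n, ∑ j ∈ Finset.range n, ∑ i' ∈ Finset.range n, ∑ j' ∈ Finset.range n, if (i : ℤ) - (j : ℤ) + ((i' : ℤ) - (j' : ℤ)) = x then (1 : ℝ) else 0) → ∀ P : ℕ → ℝ → ℤ → ℝ, P = (fun (n : ℕ) (m : ℝ) (x : ℤ) => 2 * a n x - c n x - m * (a n x - (a n (x - 1) + a n (x + 1)) / 2)) → ∀ n : ℕ, 2 ≤ n → ∀ m : ℝ, 0 ≤ m → m ≤ 1 / 2 → (∀ x : ℤ, 2 * (n : ℤ) < |x| → P n m x = 0) ∧ Summable (fun x : ℤ => (1 + (x : ℝ) ^ 2) * |P n m x|) ∧ ∑' x : ℤ, P n m x = 1 ∧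 ∑' x : ℤ, (x : ℝ) ^ 2 * P n m x = m ∧ (∀ x : ℤ, |P n m x| ≤ 4 / (n : ℝ)) ∧ (∀ k : ℝ, 0 ≤ ∑' x : ℤ, Real.cos (k * (x : ℝ)) * P n m x ∧ ∑' x : ℤ, Real.cos (k * (x : ℝ)) * P n m x ≤ 1) ∧ ∑' x : ℤ, Real.cos (2 * Real.pi / (n : ℝ) * (x : ℝ)) * P n m x = 0) → ∃ (S0 : ℤ → ℝ) (Sb : ℝ → ℤ → ℝ) (c₀ : ℝ), 0 < c₀ ∧ Summable (fun x : ℤ => (1 + (x : ℝ) ^ 2) * |S0 x|) ∧ (∀ ν : ℝ, 0 < ν → Summable (fun x : ℤ => (1 + (x : ℝ) ^ 2) * |Sb ν x|)) ∧ 0 < ∑' x : ℤ, S0 x ∧ (∀ ν : ℝ, 0 < ν → ∑' x : ℤ, Sb ν x = ∑' x : ℤ, S0 x) ∧ (∀ k : ℝ, 0 ≤ ∑' x : ℤ, Real.cos (k * (x : ℝ)) * S0 x) ∧ (∀ ν : ℝ, 0 < ν → ∀ k : ℝ, 0 ≤ ∑' x : ℤ, Real.cos (k * (x : ℝ)) *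 Sb ν x) ∧ (∀ ν : ℝ, 0 < ν → ∀ k : ℝ, ∑' x : ℤ, Real.cos (k * (x : ℝ)) * Sb ν x ≤ ∑' x : ℤ, Real.cos (k * (x : ℝ)) * S0 x) ∧ (∀ ν : ℝ, 0 < ν → ∫ t in Set.Ioi (0:ℝ), Real.exp (-(ν * t)) * (c₀ * Real.cos t) = ν / 2 * ((∑' x : ℤ, (x : ℝ) ^ 2 * Sb ν x) - ∑' x : ℤ, (x : ℝ) ^ 2 * S0 x)) ∧ (∀ M ν₁ : ℝ, 0 < ν₁ → ∃ k : ℝ, Real.cos k ≠ 1 ∧ ∃ ν : ℝ, 0 < ν ∧ ν < ν₁ ∧ M * (2 - 2 * Real.cos k) ≤ (∑' x : ℤ, Real.cos (k * (x : ℝ)) * S0 x) - ∑' x : ℤ, Real.cos (k * (x : ℝ)) * Sb ν x) ∧ (∀ ν : ℝ, 0 < ν → ∀ x : ℤ, |Sb ν x| ≤ Real.sqrt ν) ∧ (∀ τ : ℝ, 2 * ∫ s in Set.Ioc (0:ℝ) τ, (τ - s) * (c₀ * Real.cos s) ≤ 4 * c₀) ∧ ¬ Filter.Tendsto (fun ν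 : ℝ => ν⁻¹ * ∫ t in Set.Ioi (0:ℝ), Real.exp (-(ν * t)) * (c₀ * Real.cos t)) (nhdsWithin (0:ℝ) (Set.Ioi 0)) Filter.atTop := by
  exact _root_.Summit.AtomisticToContinuum.FouriersLaw.Theorems.UnboundedHeatVariance.Sketch.stub_escapeInsufficient

/-! ### Part I-ter — wave-5 stubs registered by the continuation lead c2 (cycle 3): SF, SR (weakest rungs of the IR
ladder), PE (weakening of E4 on the sign side), FR (spectral tightness: fibrewise complete relaxation does not force the infrared
charge). None is a hypothesis of `UnboundedHeatVariance_of`. -/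

/-- **SF — `stub_infraredNonFreezing_of_sequentialFibreRelaxation` (edge, the WEAKEST ergodic-type rung of the IR ladder; size S).**
In the arena: if along SOME sequence of wavenumbers `k_j → 0` (`cos k_j ≠ 1`) the Abel energy spectral function can be made
arbitrarily small at small `ν` — `∀ j ε ν₁, ∃ ν ∈ (0,ν₁), f̂_ν(k_j) ≤ ε`, i.e. (since `f̂_ν(k) ↓ σ_k{0}`) the energy density has
NO CONSERVED (flow-invariant `L²`) COMPONENT at the wavenumbers `k_j` — then IR holds: `χ` is continuous at `0` with `χ(0) > 0`
(clauses (5),(6)), so for `j` large `χ(k_j) ≥ 3χ(0)/4` and `M(2 − 2cos k_j) ≤ χ(0)/4`, and the deficit at `(k_j, ν)` is `≥ χ(0)/4`.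
Weaker hypothesis than no-frozen-site-energy (E: a.e. `k`) and than ergodicity (Erg). [folklore] -/
theorem Holds.stub_infraredNonFreezing_of_sequentialFibreRelaxation :
    ∀ ω₂ lam β γ : ℝ, 0 < ω₂ → 0 < lam → 0 < β → ∀ T : ℝ, 0 < T → ∀ μ : MeasureTheory.Measure Literature.MathematicalPhysics.KineticTheory.HeatConduction.ChainConfig, (Literature.MathematicalPhysics.KineticTheory.HeatConduction.pinnedChain ω₂ lam β γ).IsChainGibbsMeasure T μ → Literature.MathematicalPhysics.KineticTheory.HeatConduction.IsShiftInvariant μ → μ.map (fun σ : Literature.MathematicalPhysics.KineticTheory.HeatConduction.ChainConfig => fun x : ℤ => ((σ x).1, -(σ x).2)) = μ → ∀ D : Literature.MathematicalPhysics.KineticTheory.HeatConduction.InfiniteChainDynamics (Literature.MathematicalPhysics.KineticTheory.HeatConduction.pinnedChain ω₂ lam β γ), D.PreservesMeasure μ → (∀ t : ℝ, ∀ᵐ σ ∂μ, D.flow t (Literature.MathematicalPhysics.KineticTheory.HeatConduction.shift σ) = Literature.MathematicalPhysics.KineticTheory.HeatConduction.shift (D.flow t σ)) → (∀ t : ℝ,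 D.HasAbsConvergentCorrelation μ t) → Continuous (fun t : ℝ => D.currentCorrelation μ t) → ∀ h : Literature.MathematicalPhysics.KineticTheory.HeatConduction.ChainConfig → ℤ → ℝ, h = (fun (σ : Literature.MathematicalPhysics.KineticTheory.HeatConduction.ChainConfig) (x : ℤ) => (σ x).2 ^ 2 / 2 + (Literature.MathematicalPhysics.KineticTheory.HeatConduction.pinnedChain ω₂ lam β γ).U (σ x).1 + ((Literature.MathematicalPhysics.KineticTheory.HeatConduction.pinnedChain ω₂ lam β γ).V ((σ (x + 1)).1 - (σ x).1) + (Literature.MathematicalPhysics.KineticTheory.HeatConduction.pinnedChain ω₂ lam β γ).V ((σ x).1 - (σ (x - 1)).1)) / 2) → ∀ S : ℤ → ℝ → ℝ, S = (fun (x : ℤ) (t : ℝ) => ∫ σ, (h σ 0 - ∫ σ', h σ' 0 ∂μ) * (h (D.flow t σ) x - ∫ σ', h σ' 0 ∂μ) ∂μ) → ∀ Sb : ℝ → ℤ → ℝ, Sb = (fun (ν : ℝ) (x : ℤ) => ν * ∫ t in Set.Ioi (0:ℝ), Real.exp (-(ν * t)) * S x t) → ∀ fh : ℝ → ℝ → ℝ,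 fh = (fun (ν k : ℝ) => ∑' x : ℤ, Real.cos (k * (x : ℝ)) * Sb ν x) → ∀ χk : ℝ → ℝ, χk = (fun k : ℝ => ∑' x : ℤ, Real.cos (k * (x : ℝ)) * S x 0) → (∃ kseq : ℕ → ℝ, Filter.Tendsto kseq Filter.atTop (nhds 0) ∧ (∀ j : ℕ, Real.cos (kseq j) ≠ 1) ∧ ∀ j : ℕ, ∀ ε : ℝ, 0 < ε → ∀ ν₁ : ℝ, 0 < ν₁ → ∃ ν : ℝ, 0 < ν ∧ ν < ν₁ ∧ fh ν (kseq j) ≤ ε) → ∀ M ν₁ : ℝ, 0 < ν₁ → ∃ k : ℝ, Real.cos k ≠ 1 ∧ ∃ ν : ℝ, 0 < ν ∧ ν < ν₁ ∧ M * (2 - 2 * Real.cos k) ≤ χk k - fh ν k := by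
  exact _root_.Summit.AtomisticToContinuum.FouriersLaw.Theorems.UnboundedHeatVariance.Sketch.stub_infraredNonFreezing_of_sequentialFibreRelaxation

/-- **SR — `stub_noFrozenSiteEnergy_of_cesaroRelaxation` (edge: MEAN-ERGODICITY OF THE SITE ENERGY in Cesàro form gives the Abel
form consumed by E; size S).** In the arena: if `T⁻¹∫_{(0,T]} S(0,t)dt → 0` as `T → ∞` (the local energy autocorrelation relaxes
on average — implied by mixing of `h₀`, by `S(0,t) → 0`, by ergodicity), then `S̄_ν(0) = ν∫₀^∞e^{-νt}S(0,t)dt → 0` as `ν ↓ 0`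
(Widder's Abelian lemma `Literature.Analysis.Asymptotics.Widder1941_abelian_laplace_one` + `_holds`, integrability from FibreCalculus
clause (3) and continuity of `t ↦ S(0,t)`). Rider (same file): pointwise relaxation `S(0,t) → 0` ⟹ the Cesàro hypothesis. [folklore; Widder1941] -/
theorem Holds.stub_noFrozenSiteEnergy_of_cesaroRelaxation :
    ∀ ω₂ lam β γ : ℝ, 0 < ω₂ → 0 < lam → 0 < β → ∀ T : ℝ, 0 < T → ∀ μ : MeasureTheory.Measure Literature.MathematicalPhysics.KineticTheory.HeatConduction.ChainConfig, (Literature.MathematicalPhysics.KineticTheory.HeatConduction.pinnedChain ω₂ lam β γ).IsChainGibbsMeasure T μ → Literature.MathematicalPhysics.KineticTheory.HeatConduction.IsShiftInvariant μ → μ.map (fun σ : Literature.MathematicalPhysics.KineticTheory.HeatConduction.ChainConfig => fun x : ℤ => ((σ x).1, -(σ x).2)) = μ → ∀ D : Literature.MathematicalPhysics.KineticTheory.HeatConduction.InfiniteChainDynamics (Literature.MathematicalPhysics.KineticTheory.HeatConduction.pinnedChain ω₂ lam β γ), D.PreservesMeasure μ → (∀ t : ℝ, ∀ᵐ σ ∂μ,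 D.flow t (Literature.MathematicalPhysics.KineticTheory.HeatConduction.shift σ) = Literature.MathematicalPhysics.KineticTheory.HeatConduction.shift (D.flow t σ)) → (∀ t : ℝ, D.HasAbsConvergentCorrelation μ t) → Continuous (fun t : ℝ => D.currentCorrelation μ t) → ∀ h : Literature.MathematicalPhysics.KineticTheory.HeatConduction.ChainConfig → ℤ → ℝ, h = (fun (σ : Literature.MathematicalPhysics.KineticTheory.HeatConduction.ChainConfig) (x : ℤ) => (σ x).2 ^ 2 / 2 + (Literature.MathematicalPhysics.KineticTheory.HeatConduction.pinnedChain ω₂ lam β γ).U (σ x).1 + ((Literature.MathematicalPhysics.KineticTheory.HeatConduction.pinnedChain ω₂ lam β γ).V ((σ (x + 1)).1 - (σ x).1) + (Literature.MathematicalPhysics.KineticTheory.HeatConduction.pinnedChain ω₂ lam β γ).V ((σ x).1 - (σ (x - 1)).1)) / 2) → ∀ S : ℤ → ℝ → ℝ, S = (fun (x : ℤ) (t : ℝ) => ∫ σ, (h σ 0 - ∫ σ', h σ' 0 ∂μ) * (h (D.flow t σ) x - ∫ σ', h σ' 0 ∂μ) ∂μ) → ∀ Sb : ℝ → ℤ →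 ℝ, Sb = (fun (ν : ℝ) (x : ℤ) => ν * ∫ t in Set.Ioi (0:ℝ), Real.exp (-(ν * t)) * S x t) → Filter.Tendsto (fun T : ℝ => (∫ t in Set.Ioc (0:ℝ) T, S 0 t) / T) Filter.atTop (nhds 0) → Filter.Tendsto (fun ν : ℝ => Sb ν 0) (nhdsWithin (0:ℝ) (Set.Ioi 0)) (nhds 0) := by
  exact _root_.Summit.AtomisticToContinuum.FouriersLaw.Theorems.UnboundedHeatVariance.Sketch.stub_noFrozenSiteEnergy_of_cesaroRelaxation

/-- **PE — `stub_relativeNegativeSpread_of_eventualAbelEnergyPositivity` (edge on the SIGN side, weakening E4; size M).** In the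
arena: if the Abel energy profile is non-negative OUTSIDE A FIXED CORE for small `ν` — `∃ R₀ ν₀, ∀ ν ∈ (0,ν₀), ∀ |x| ≥ R₀,
S̄_ν(x) ≥ 0` (negative energy–energy correlations confined to `|x| < R₀`: the "cage dip" region seen in MD) — then P holds with
`θ = 0`: inside the core `x²(S(x,0) − S̄_ν(x))⁺ ≤ R₀²(|S(x,0)| + |S̄_ν(x)|)` with `|S̄_ν(x)| ≤ S̄_ν(0) ≤ S(0,0)` (landed D
`stub_abelProfileDomination` and Cauchy–Schwarz `|S(0,t)| ≤ S(0,0)` along the measure-preserving flow), outside it only the static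
term `x²S(x,0)⁺` survives, summable by clause (5). [folklore] -/
theorem Holds.stub_relativeNegativeSpread_of_eventualAbelEnergyPositivity :
    ∀ ω₂ lam β γ : ℝ, 0 < ω₂ → 0 < lam → 0 < β → ∀ T : ℝ, 0 < T → ∀ μ : MeasureTheory.Measure Literature.MathematicalPhysics.KineticTheory.HeatConduction.ChainConfig, (Literature.MathematicalPhysics.KineticTheory.HeatConduction.pinnedChain ω₂ lam β γ).IsChainGibbsMeasure T μ → Literature.MathematicalPhysics.KineticTheory.HeatConduction.IsShiftInvariant μ → μ.map (fun σ : Literature.MathematicalPhysics.KineticTheory.HeatConduction.ChainConfig => fun x : ℤ => ((σ x).1, -(σ x).2)) = μ → ∀ D : Literature.MathematicalPhysics.KineticTheory.HeatConduction.InfiniteChainDynamics (Literature.MathematicalPhysics.KineticTheory.HeatConduction.pinnedChain ω₂ lam β γ), D.PreservesMeasure μ → (∀ t : ℝ, ∀ᵐ σ ∂μ, D.flow t (Literature.MathematicalPhysics.KineticTheory.HeatConduction.shift σ) = Literature.MathematicalPhysics.KineticTheory.HeatConduction.shift (D.flow t σ)) → (∀ t : ℝ, D.HasAbsConvergentCorrelation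 μ t) → Continuous (fun t : ℝ => D.currentCorrelation μ t) → ∀ h : Literature.MathematicalPhysics.KineticTheory.HeatConduction.ChainConfig → ℤ → ℝ, h = (fun (σ : Literature.MathematicalPhysics.KineticTheory.HeatConduction.ChainConfig) (x : ℤ) => (σ x).2 ^ 2 / 2 + (Literature.MathematicalPhysics.KineticTheory.HeatConduction.pinnedChain ω₂ lam β γ).U (σ x).1 + ((Literature.MathematicalPhysics.KineticTheory.HeatConduction.pinnedChain ω₂ lam β γ).V ((σ (x + 1)).1 - (σ x).1) + (Literature.MathematicalPhysics.KineticTheory.HeatConduction.pinnedChain ω₂ lam β γ).V ((σ x).1 - (σ (x - 1)).1)) / 2) → ∀ S : ℤ → ℝ → ℝ, S = (fun (x : ℤ) (t : ℝ) => ∫ σ, (h σ 0 - ∫ σ', h σ' 0 ∂μ) * (h (D.flow t σ) x - ∫ σ', h σ' 0 ∂μ) ∂μ) → ∀ Sb : ℝ → ℤ → ℝ, Sb = (fun (ν : ℝ) (x : ℤ) => ν * ∫ t in Set.Ioi (0:ℝ), Real.exp (-(ν * t)) * S x t) → (∃ R₀ : ℕ, ∃ ν₀ : ℝ, 0 < ν₀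 ∧ ∀ ν : ℝ, 0 < ν → ν < ν₀ → ∀ x : ℤ, (R₀ : ℤ) ≤ |x| → 0 ≤ Sb ν x) → ∃ θ K ν₀ : ℝ, θ < 1 ∧ 0 < ν₀ ∧ ∀ ν : ℝ, 0 < ν → ν < ν₀ → ∑' x : ℤ, (x : ℝ) ^ 2 * max (S x 0 - Sb ν x) 0 ≤ θ * (∑' x : ℤ, (x : ℝ) ^ 2 * max (Sb ν x - S x 0) 0) + K := by
  exact _root_.Summit.AtomisticToContinuum.FouriersLaw.Theorems.UnboundedHeatVariance.Sketch.stub_relativeNegativeSpread_of_eventualAbelEnergyPositivity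

/-- **FR — `stub_fibrewiseRelaxationInsufficient` (SPECTRAL TIGHTNESS, companion of X in the language of line `birth`; size M).**
Dictionary: `σ_k` = spectral measure of the energy-density fibre `h(k)` under the Liouvillian (mass `χ(k)`; at `k = 0` the total energy
is conserved, `σ_0 = χ(0)δ_0`), `ρ_k := ω²σ_k/(2 − 2cos k)` = spectral measure of the current fibre `j(k)` (continuity equation
`L h(k) = (1 − e^{-ik})j(k)`), `ρ₀` = birth's representing measure of `C` (S1); absolutely summable correlations make `k ↦ σ_k` and
`k ↦ ρ_k` weakly continuous, `ρ_k → ρ₀`; birth: U ⟺ `ρ₀` charges the infrared (`0 < ρ₀{0} ∨ ∫ω⁻²dρ₀ = ∞`, S2, p162185/p161493).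
FIBREWISE COMPLETE RELAXATION `σ_k{0} = 0` for EVERY `k ∉ 2πℤ` (no flow-invariant `L²` component of the energy at any non-zero
wavenumber — the strongest ergodic input of this kind, implying no frozen site energy, SF's hypothesis and IR) does NOT force the
infrared charge: explicit witness `χ = 4`, `η(k) = 1 − cos k` (DIFFUSIVE dispersion `≈ k²/2`, undamped: the coherent "second-sound"
enemy of P), `σ_k = (1 − cos k)(δ_1 + δ_{-1}) + (2 − η(k))(δ_{η(k)} + δ_{-η(k)})`, `ρ_k = ½(δ_1+δ_{-1}) + (2−η)η·½(δ_η+δ_{-η}) → ρ₀ =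
½(δ_1 + δ_{-1})`, whose kernel `C = cos` is the abstract cage (`V = 2(1 − cos τ) ≤ 4`, Negative.AbstractCage). Fatou runs the wrong
way: `∫ω⁻²dρ₀ ≤ liminf ∫ω⁻²dρ_k = +∞` carries no information. [folklore] -/
theorem Holds.stub_fibrewiseRelaxationInsufficient :
    ∃ (χ : ℝ) (σ : ℝ → MeasureTheory.Measure ℝ) (ρ₀ : MeasureTheory.Measure ℝ), 0 < χ ∧ (∀ k : ℝ, MeasureTheory.IsFiniteMeasure (σ k)) ∧ (∀ k : ℝ, σ k Set.univ = ENNReal.ofReal χ) ∧ σ 0 = ENNReal.ofReal χ • MeasureTheory.Measure.dirac (0:ℝ) ∧ (∀ k : ℝ, Real.cos k ≠ 1 → σ k {0} = 0) ∧ (∀ k : ℝ, (σ k).map (fun w : ℝ => -w) = σ k) ∧ (∀ g : ℝ → ℝ, Continuous g → (∃ B : ℝ, ∀ w : ℝ, |g w| ≤ B) → Filter.Tendsto (fun k : ℝ => ∫ w, g w ∂(σ k)) (nhds 0) (nhds (∫ w, g w ∂(σ 0)))) ∧ MeasureTheory.IsFiniteMeasure ρ₀ ∧ 0 < ρ₀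 Set.univ ∧ (∀ g : ℝ → ℝ, Continuous g → (∃ B : ℝ, ∀ w : ℝ, |g w| ≤ B) → Filter.Tendsto (fun k : ℝ => ∫ w, g w * (w ^ 2 / (2 - 2 * Real.cos k)) ∂(σ k)) (nhdsWithin (0:ℝ) {k : ℝ | Real.cos k ≠ 1}) (nhds (∫ w, g w ∂ρ₀))) ∧ ρ₀ {0} = 0 ∧ MeasureTheory.Integrable (fun w : ℝ => (w ^ 2)⁻¹) ρ₀ ∧ (∀ τ : ℝ, 0 ≤ τ → 2 * ∫ s in Set.Ioc (0:ℝ) τ, (τ - s) * (∫ w, Real.cos (w * s) ∂ρ₀) ≤ 4) ∧ ¬ (0 < ρ₀ {0} ∨ ¬ MeasureTheory.Integrable (fun w : ℝ => (w ^ 2)⁻¹) ρ₀) := by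
  exact _root_.Summit.AtomisticToContinuum.FouriersLaw.Theorems.UnboundedHeatVariance.Sketch.stub_fibrewiseRelaxationInsufficient

/-! ### By-name handles -/

/-- Statement of registered stub S_A (`Holds.stub_chebyshevSandwich`), by name. -/
def stub_chebyshevSandwich : Prop := type_of% Holds.stub_chebyshevSandwich

/-- Statement of registered stub S_T (`Holds.stub_abelSandwichTransfer`), by name. -/
def stub_abelSandwichTransfer : Prop := type_of% Holds.stub_abelSandwichTransfer

/-- Statement of registered stub S_P (`Holds.stub_relativeNegativeSpread`), by name. -/
def stub_relativeNegativeSpread : Prop := type_of% Holds.stub_relativeNegativeSpread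

/-- Statement of registered stub S_IR (`Holds.stub_infraredNonFreezing`), by name. -/
def stub_infraredNonFreezing : Prop := type_of% Holds.stub_infraredNonFreezing

/-- Statement of registered edge D (`Holds.stub_abelProfileDomination`), by name. -/
def stub_abelProfileDomination : Prop := type_of% Holds.stub_abelProfileDomination

/-- Statement of registered edge R (`Holds.stub_unboundedHeatVariance_iff_exists`), by name. -/
def stub_unboundedHeatVariance_iff_exists : Prop := type_of% Holds.stub_unboundedHeatVariance_iff_exists

/-- Statement of registered edge Erg (`Holds.stub_noFrozenSiteEnergy_of_ergodic`), by name. -/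
def stub_noFrozenSiteEnergy_of_ergodic : Prop := type_of% Holds.stub_noFrozenSiteEnergy_of_ergodic

/-- Statement of registered stub F (`Holds.stub_flatFejerProfile`), by name. -/
def stub_flatFejerProfile : Prop := type_of% Holds.stub_flatFejerProfile

/-- Statement of registered stub X (`Holds.stub_escapeInsufficient`), by name. -/
def stub_escapeInsufficient : Prop := type_of% Holds.stub_escapeInsufficient

/-- Statement of registered edge SF (`Holds.stub_infraredNonFreezing_of_sequentialFibreRelaxation`), by name. -/
def stub_infraredNonFreezing_of_sequentialFibreRelaxation : Prop :=
  type_of% Holds.stub_infraredNonFreezing_of_sequentialFibreRelaxation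

/-- Statement of registered edge SR (`Holds.stub_noFrozenSiteEnergy_of_cesaroRelaxation`), by name. -/
def stub_noFrozenSiteEnergy_of_cesaroRelaxation : Prop := type_of% Holds.stub_noFrozenSiteEnergy_of_cesaroRelaxation

/-- Statement of registered edge PE (`Holds.stub_relativeNegativeSpread_of_eventualAbelEnergyPositivity`), by name. -/
def stub_relativeNegativeSpread_of_eventualAbelEnergyPositivity : Prop :=
  type_of% Holds.stub_relativeNegativeSpread_of_eventualAbelEnergyPositivity

/-- Statement of registered stub FR (`Holds.stub_fibrewiseRelaxationInsufficient`), by name. -/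
def stub_fibrewiseRelaxationInsufficient : Prop := type_of% Holds.stub_fibrewiseRelaxationInsufficient

/-! ## Part II — the skeleton theorem: the four stubs give the crux BY NAME (sorry-free) -/

/-- **`UnboundedHeatVariance_of`** — S_P → S_IR → `CageBudgetFekete.UnboundedHeatVariance`: the LANDED transfer S_T
(`Sketch.stub_abelSandwichTransfer`, p165506) fed with the LANDED Chebyshev lemma S_A (`Sketch.stub_chebyshevSandwich`, p165461)
turns P and IR into the Abel divergence S2′ arena by arena, and the LANDED equivalence `Birth.unboundedHeatVariance_iff_abel`
(line `birth`, p162185) concludes the crux by name. Kernel-checked; axioms propext / Classical.choice / Quot.sound modulo the two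
open stubs. [folklore] -/
theorem UnboundedHeatVariance_of (hSP : stub_relativeNegativeSpread) (hSIR : stub_infraredNonFreezing) :
    _root_.Summit.AtomisticToContinuum.FouriersLaw.Theses.CageBudgetFekete.UnboundedHeatVariance := by
  refine (_root_.Summit.AtomisticToContinuum.FouriersLaw.Theorems.UnboundedHeatVariance.Birth.unboundedHeatVariance_iff_abel).2 ?_
  intro ω₂ lam β γ hω hl hβ T hT μ hG hSI hRefl D hPres hShift hAC hCc
  exact Holds.stub_abelSandwichTransfer Holds.stub_chebyshevSandwich
    ω₂ lam β γ hω hl hβ T hT μ hG hSI hRefl D hPres hShift hAC hCc _ rfl _ rfl _ rfl _ rfl _ rfl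
    (hSP ω₂ lam β γ hω hl hβ T hT μ hG hSI hRefl D hPres hShift hAC hCc _ rfl _ rfl _ rfl)
    (hSIR ω₂ lam β γ hω hl hβ T hT μ hG hSI hRefl D hPres hShift hAC hCc _ rfl _ rfl _ rfl _ rfl _ rfl)

/-- D-0027 §3.3 shape: the crux from the stubs (an `example`, so that `UnboundedHeatVariance_of` stays the unique
theorem concluding the crux). -/
example : _root_.Summit.AtomisticToContinuum.FouriersLaw.Theses.CageBudgetFekete.UnboundedHeatVariance :=
  UnboundedHeatVariance_of Holds.stub_relativeNegativeSpread Holds.stub_infraredNonFreezing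

end Summit.AtomisticToContinuum.FouriersLaw.Cruxes.UnboundedHeatVariance.Sketch

end
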